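import Mathlib.Analysis.InnerProductSpace.PiL2
import Mathlib.Data.Set.Card
import Literature.Geometry.DiscreteGeometry.BondGraph
import HarnessLib

/-!
# No over-coordination at tolerance `1/100` from the `1 %`-gapped kissing bound

Stub `stub_noOvercoordination_of_gappedKissing` (O2) of the line `birth` for the crux
`PricedLinkCensus.TruncatedCensusGap` (item stmt-AtomisticToContinuum-14230).  The statement below is
the registered signature VERBATIM (self-contained over the tree declarations `nearestDist`,
`bondGraph` of `Literature/Geometry/DiscreteGeometry/BondGraph.lean`).

THE REDUCTION.  In the scale-free bond graph `bondGraph (1/100) y` of an injective configuration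
`y : Fin N → ℝ³` (`j ∼ k ↔ j ≠ k ∧ dist (y j) (y k) ≤ 1.01 · min (nn_j) (nn_k)`), fix a site `i` and
two distinct bond-neighbours `j, k` of `i`; put `p = y j − y i`, `q = y k − y i`.  Then
* `‖p‖ ≤ 1.01 · nn_i ≤ 1.01 · ‖q‖` and symmetrically (`dist_le_of_adj`, `nearestDist_le_dist`):
  the bonds at `i` have comparable lengths;
* `‖p‖ ≤ 1.01 · nn_j ≤ 1.01 · ‖p − q‖` and symmetrically (adjacency uses the scale of BOTH ends):
  the far ends are separated relative to the bond lengths;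
* hence, with `a = ‖p‖ ≤ b = ‖q‖` (wlog) and `λ = (100/101)²`,
  `⟪p, q⟫ = (a² + b² − ‖p − q‖²)/2 ≤ (a² + (1 − λ) b²)/2 ≤ (1 − λ/2)·a·b`, the last step being
  `(b − a)·(a − (1 − λ) b) ≥ 0` (`a ≥ b/1.01 ≥ (1 − λ) b`);
* so the unit bond directions `‖p‖⁻¹ • p` are pairwise at inner product `≤ 1 − λ/2`, i.e. at chord
  distance `≥ 100/101`, and distinct neighbours have distinct directions.
The gapped kissing hypothesis applied to the image of the direction map on the neighbour finset
bounds the number of bond-neighbours by twelve (`Finset.card_image_of_injOn`, `Set.ncard_coe_finset`).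
Injectivity is used exactly once: bonds have positive length (coincident sites are bonded).

Template: `Theorems/TwelveWithinOne/Negative/LoadBearingAndSharpness.lean`, Part B (absolute shell
`[55/57, 1]`); here the shell and the separation are relative, handled by the case split `a ≤ b ∨ b ≤ a`.
-/

noncomputable section

namespace Summit.AtomisticToContinuum.Crystallization.Theorems.PricedLinkCensusTruncatedCensusGap

open RealInnerProductSpace
open Literature.Geometry.DiscreteGeometry

/-- Two vectors `p, q` of comparable lengths (`‖p‖ ≤ 1.01 ‖q‖`, `‖q‖ ≤ 1.01 ‖p‖`) whose difference is
not much shorter than either (`‖p‖, ‖q‖ ≤ 1.01 ‖p − q‖`) make an angle with cosine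
`≤ 1 − (100/101)²/2` (worst case `‖p‖ = ‖q‖ = 1.01 ‖p − q‖`). [folklore] -/
theorem gappedKissing_inner_normalized_le {p q : EuclideanSpace ℝ (Fin 3)} (hp : 0 < ‖p‖)
    (hq : 0 < ‖q‖) (hpq : ‖p‖ ≤ (101 / 100 : ℝ) * ‖q‖) (hqp : ‖q‖ ≤ (101 / 100 : ℝ) * ‖p‖)
    (hpd : ‖p‖ ≤ (101 / 100 : ℝ) * ‖p - q‖) (hqd : ‖q‖ ≤ (101 / 100 : ℝ) * ‖p - q‖) :
    ⟪‖p‖⁻¹ • p, ‖q‖⁻¹ • q⟫ ≤ 1 - ((100 : ℝ) / 101) ^ 2 / 2 := by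
  have hinner : ⟪p, q⟫ = (‖p‖ ^ 2 + ‖q‖ ^ 2 - ‖p - q‖ ^ 2) / 2 := by
    rw [norm_sub_sq_real]; ring
  have hpd2 : ‖p‖ ^ 2 ≤ ((101 : ℝ) / 100 * ‖p - q‖) ^ 2 := pow_le_pow_left₀ hp.le hpd 2
  have hqd2 : ‖q‖ ^ 2 ≤ ((101 : ℝ) / 100 * ‖p - q‖) ^ 2 := pow_le_pow_left₀ hq.le hqd 2
  have key : ⟪p, q⟫ ≤ (1 - ((100 : ℝ) / 101) ^ 2 / 2) * (‖p‖ * ‖q‖) := by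
    rw [hinner]
    rcases le_total ‖p‖ ‖q‖ with h | h
    · have h' : 0 ≤ ‖p‖ - (1 - ((100 : ℝ) / 101) ^ 2) * ‖q‖ := by nlinarith
      nlinarith [mul_nonneg (sub_nonneg.2 h) h']
    · have h' : 0 ≤ ‖q‖ - (1 - ((100 : ℝ) / 101) ^ 2) * ‖p‖ := by nlinarith
      nlinarith [mul_nonneg (sub_nonneg.2 h) h']
  rw [real_inner_smul_left, real_inner_smul_right, ← mul_assoc, ← mul_inv,
    inv_mul_le_iff₀ (by positivity)]
  linarith [key]

variable {N : ℕ}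

/-- Bonds of an injective configuration have positive length. [folklore] -/
theorem gappedKissing_norm_sub_pos {y : Fin N → EuclideanSpace ℝ (Fin 3)} (hy : Function.Injective y)
    {i j : Fin N} (hj : (bondGraph (1 / 100 : ℝ) y).Adj i j) : 0 < ‖y j - y i‖ :=
  norm_sub_pos_iff.2 fun h => hj.ne (hy h).symm

/-- A bond at `i` (tolerance `1/100`) is at most `1.01` times as long as the distance from `i` to any
other site. [folklore] -/
theorem gappedKissing_norm_sub_le {y : Fin N → EuclideanSpace ℝ (Fin 3)} {i j k : Fin N}
    (hj : (bondGraph (1 / 100 : ℝ) y).Adj i j) (hk : k ≠ i) :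
    ‖y j - y i‖ ≤ (101 / 100 : ℝ) * ‖y k - y i‖ := by
  rw [← dist_eq_norm, ← dist_eq_norm, dist_comm (y j), dist_comm (y k)]
  calc dist (y i) (y j) ≤ (1 + 1 / 100 : ℝ) * nearestDist y i := dist_le_of_adj (by norm_num) hj
    _ = (101 / 100 : ℝ) * nearestDist y i := by norm_num
    _ ≤ (101 / 100 : ℝ) * dist (y i) (y k) :=
        mul_le_mul_of_nonneg_left (nearestDist_le_dist y hk) (by norm_num)

/-- A bond `{i, j}` (tolerance `1/100`) is at most `1.01` times as long as the distance from `j` to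
any other site `k`, written on the bond vectors at `i`. [folklore] -/
theorem gappedKissing_norm_sub_le_sep {y : Fin N → EuclideanSpace ℝ (Fin 3)} {i j k : Fin N}
    (hj : (bondGraph (1 / 100 : ℝ) y).Adj i j) (hk : k ≠ j) :
    ‖y j - y i‖ ≤ (101 / 100 : ℝ) * ‖(y j - y i) - (y k - y i)‖ := by
  rw [sub_sub_sub_cancel_right, ← dist_eq_norm, ← dist_eq_norm]
  calc dist (y j) (y i) ≤ (1 + 1 / 100 : ℝ) * nearestDist y j := dist_le_of_adj (by norm_num) hj.symm
    _ = (101 / 100 : ℝ) * nearestDist y j := by norm_num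
    _ ≤ (101 / 100 : ℝ) * dist (y j) (y k) :=
        mul_le_mul_of_nonneg_left (nearestDist_le_dist y hk) (by norm_num)

/-- Bond directions of an injective configuration are unit vectors. [folklore] -/
theorem gappedKissing_norm_dir {y : Fin N → EuclideanSpace ℝ (Fin 3)} (hy : Function.Injective y)
    {i j : Fin N} (hj : (bondGraph (1 / 100 : ℝ) y).Adj i j) :
    ‖(‖y j - y i‖⁻¹ • (y j - y i))‖ = 1 := by
  rw [norm_smul, norm_inv, norm_norm, inv_mul_cancel₀ (gappedKissing_norm_sub_pos hy hj).ne']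

/-- Two distinct bonds at a site of an injective configuration (tolerance `1/100`) make an angle with
cosine `≤ 1 − (100/101)²/2`. [folklore] -/
theorem gappedKissing_inner_dir_le {y : Fin N → EuclideanSpace ℝ (Fin 3)} (hy : Function.Injective y)
    {i j k : Fin N} (hj : (bondGraph (1 / 100 : ℝ) y).Adj i j) (hk : (bondGraph (1 / 100 : ℝ) y).Adj i k)
    (hjk : j ≠ k) :
    ⟪‖y j - y i‖⁻¹ • (y j - y i), ‖y k - y i‖⁻¹ • (y k - y i)⟫ ≤ 1 - ((100 : ℝ) / 101) ^ 2 / 2 := by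
  refine gappedKissing_inner_normalized_le (gappedKissing_norm_sub_pos hy hj)
    (gappedKissing_norm_sub_pos hy hk) (gappedKissing_norm_sub_le hj hk.ne.symm)
    (gappedKissing_norm_sub_le hk hj.ne.symm) (gappedKissing_norm_sub_le_sep hj hjk.symm) ?_
  rw [← norm_sub_rev (y k - y i)]
  exact gappedKissing_norm_sub_le_sep hk hjk

/-- … hence their directions are at chord distance `≥ 100/101`. [folklore] -/
theorem gappedKissing_dist_dir_ge {y : Fin N → EuclideanSpace ℝ (Fin 3)} (hy : Function.Injective y)
    {i j k : Fin N} (hj : (bondGraph (1 / 100 : ℝ) y).Adj i j) (hk : (bondGraph (1 / 100 : ℝ) y).Adj i k)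
    (hjk : j ≠ k) :
    (100 / 101 : ℝ) ≤ dist (‖y j - y i‖⁻¹ • (y j - y i)) (‖y k - y i‖⁻¹ • (y k - y i)) := by
  have hin := gappedKissing_inner_dir_le hy hj hk hjk
  have hsq : dist (‖y j - y i‖⁻¹ • (y j - y i)) (‖y k - y i‖⁻¹ • (y k - y i)) ^ 2 =
      2 - 2 * ⟪‖y j - y i‖⁻¹ • (y j - y i), ‖y k - y i‖⁻¹ • (y k - y i)⟫ := by
    rw [dist_eq_norm, norm_sub_sq_real, gappedKissing_norm_dir hy hj, gappedKissing_norm_dir hy hk]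
    ring
  nlinarith [dist_nonneg (x := ‖y j - y i‖⁻¹ • (y j - y i)) (y := ‖y k - y i‖⁻¹ • (y k - y i))]

/-- … and distinct bond-neighbours have distinct directions. [folklore] -/
theorem gappedKissing_dir_ne {y : Fin N → EuclideanSpace ℝ (Fin 3)} (hy : Function.Injective y)
    {i j k : Fin N} (hj : (bondGraph (1 / 100 : ℝ) y).Adj i j) (hk : (bondGraph (1 / 100 : ℝ) y).Adj i k)
    (hjk : j ≠ k) : ‖y j - y i‖⁻¹ • (y j - y i) ≠ ‖y k - y i‖⁻¹ • (y k - y i) := by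
  intro h
  have h1 := gappedKissing_inner_dir_le hy hj hk hjk
  rw [h, real_inner_self_eq_norm_sq, gappedKissing_norm_dir hy hk] at h1
  norm_num at h1

/-- **STUB (O2)** — the bond-graph reduction: the `1 %`-gapped kissing bound on `S²` gives no
over-coordination at tolerance `1/100` for injective configurations (the bond directions at a site
form a spherical `100/101`-code with one point per bond-neighbour). [folklore] -/
theorem stub_noOvercoordination_of_gappedKissing :
    (∀ T : Finset (EuclideanSpace ℝ (Fin 3)), (∀ v ∈ T, ‖v‖ = 1) →
      (∀ v ∈ T, ∀ w ∈ T, v ≠ w → (100 / 101 : ℝ) ≤ dist v w) → T.card ≤ 12) →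
    ∀ (N : ℕ) (y : Fin N → EuclideanSpace ℝ (Fin 3)), Function.Injective y → ∀ i : Fin N,
      ((Literature.Geometry.DiscreteGeometry.bondGraph (1 / 100 : ℝ) y).neighborSet i).ncard ≤ 12 := by
  intro hK N y hy i
  classical
  set S : Finset (Fin N) := Finset.univ.filter fun j => (bondGraph (1 / 100 : ℝ) y).Adj i j with hSdef
  have hmem : ∀ j ∈ S, (bondGraph (1 / 100 : ℝ) y).Adj i j := fun j hj => (Finset.mem_filter.1 hj).2
  have hS : (bondGraph (1 / 100 : ℝ) y).neighborSet i = (S : Set (Fin N)) := by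
    ext j
    simp only [SimpleGraph.mem_neighborSet, hSdef, Finset.coe_filter, Finset.mem_univ, true_and,
      Set.mem_setOf_eq]
  rw [hS, Set.ncard_coe_finset,
    ← Finset.card_image_of_injOn (f := fun j => ‖y j - y i‖⁻¹ • (y j - y i)) ?_]
  · refine hK _ ?_ ?_
    · intro v hv
      obtain ⟨j, hj, rfl⟩ := Finset.mem_image.1 hv
      exact gappedKissing_norm_dir hy (hmem j hj)
    · intro v hv w hw hvw
      obtain ⟨j, hj, rfl⟩ := Finset.mem_image.1 hv
      obtain ⟨k, hk, rfl⟩ := Finset.mem_image.1 hw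
      exact gappedKissing_dist_dir_ge hy (hmem j hj) (hmem k hk) fun h => hvw (by simp only [h])
  · intro j hj k hk hjk
    by_contra hne
    exact gappedKissing_dir_ne hy (hmem j hj) (hmem k hk) hne hjk

end Summit.AtomisticToContinuum.Crystallization.Theorems.PricedLinkCensusTruncatedCensusGap
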